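import Summits.QuantumFields.YangMills.Theorems.FluctuationComparisonRegPrIntLS2BetaRowTransportVariance
import HarnessLib

/-!
# k-LEG TAXICAB STAIRCASE STOKES: two parallel rows compared along an arbitrary transverse staircase cost the SUM of the rectangle holonomies swept by its legs
# (crux `FluctuationComparisonRegPrIntL`, stmt-QuantumFields-20520; registry v11.4 `Cruxes/FluctuationComparisonRegPrIntL/Lines/semiclassical_s2beta.lean` 3732b7df FROZEN, untouched)

Cell `ym3-torus` (YM ladder rung R3 = continuum `SU(2)` Yang–Mills on the three-torus — a RUNG: NOT d = 4, NOT infinite volume, NOT a mass gap, NOT Clay).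
Width seat `ym3-torus-px21` (gen 21); `--kind proof --supports stmt-QuantumFields-20520 --as helper`, count-neutral, DEFINITION-FREE (0 `def`, 0 `instance`,
0 `notation`, 0 `sorry`, default heartbeats).  Pure lattice kinematics for ANY gauge group `G` (`GaugeGroup`) on ANY torus `T^{(j)}` of the tree's `Params`, in the
currency of lit ✓`B10Eq47AxialChi` (`shiftN` ∕ `rowProd` ∕ `rect`) and of ✓p812130 (7) `…S2BetaRowTransportVariance` (whose two-leg staircases FF ∕ FB are the case `k = 2`).

WHY.  The depth-uniform flat growth letter `hFlat` (third hypothesis of ✓p811100 px16 g19 (D10); px20 g18 UV3-NODE §53; HOME note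
`ym3-torus-px12/g22/HFLAT-ROAD-AFTER-6.px12g22.md` §3) prices the inter-block half of the residual-orbit distance through the VARIANCE of through-face row transporters;
instr1 FL-27 (3)(4) says the on-target pair families are the DIFFUSE ones (cone ∕ digital-segment connectors), i.e. transverse connectors with MANY legs, not (7)'s two.  The
non-abelian Stokes inequality holds surface by surface; this file types it for the staircase surface swept by a `k`-leg transverse taxicab connector: the comparison holonomy
`C = T_{z₀} · Γ^{far} · T_{z_k}⁻¹ · (Γ^{near})⁻¹` of the two rows of length `N` (direction `μ`) through the corners `z₀`, `z_k`, with `Γ^{near}` the connector through the corners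
`z₀, z₁, …, z_k` (leg `i` a straight segment of `n_i` bonds in a transverse direction `ν_i`, traversed forward or backward) and `Γ^{far}` its translate by `N e_μ`, satisfies
`dist1 C ≤ Σ_{i<k} dist1 U(∂R_i)`, `R_i` the `N × n_i` rectangle swept by leg `i` — hence (Cauchy–Schwarz) `dist1 C² ≤ k · Σ_i dist1 U(∂R_i)²`, and leg by leg (7)'s Stokes in squares.

WHAT.  §1 the group-level telescope (any `GaugeGroup`): ★`dist1_rowTelescope_le` — for row transporters `T_i` and connectors `g_i` (near), `g′_i` (far),
`dist1 (T₀ · Π g′ · T_k⁻¹ · (Π g)⁻¹) ≤ Σ_{i<k} dist1 (T_i g′_i T_{i+1}⁻¹ g_i⁻¹)` (ordered `List.prod`; gluing identity `C_{k+1} = C_k · Ad_{Π_{i<k} g_i}(T_k g′_k T_{k+1}⁻¹ g_k⁻¹)`,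
conjugation invariance + subadditivity of `dist1`), and its squared edition `dist1_rowTelescope_sq_le`.  §2 the one-leg terms on the lattice: a FORWARD leg gives the rectangle holonomy on
the nose (`oneLeg_fwd_eq_rect`, definitional), a BACKWARD leg gives a conjugate of its inverse (`dist1_oneLeg_bwd_eq`).  §3 ★★`dist1_stairCompare_le_sum_rect` (signed legs, corners
`z : ℕ → Site`, signs `s : ℕ → Bool`, chain hypotheses `s i → z (i+1) = z i + n_i e_{ν_i}`, `¬ s i → z i = z (i+1) + n_i e_{ν_i}`; rectangle of leg `i` based at its LOWER corner),
★★`dist1_stairCompare_sq_le` (`≤ k · Σ_i dist1 U(∂R_i)²`), ★★`dist1_stairCompare_sq_le_plaq` (`≤ k · Σ_i (N·n_i) · Σ_{plaquettes of R_i} dist1²`, via (7) `dist1_rect_sq_le`, `μ ≠ ν_i`),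
`dist1_stairCompare_le_plaq` (linear, plaquette form); §4 the monotone (all-forward) staircase without signs: `dist1_stairCompareFwd_le_sum_rect`, `dist1_stairCompareFwd_sq_le_plaq`.

HONEST: kinematics (subadditivity and conjugation invariance of `dist1`, Cauchy–Schwarz, reindexing); NOT the pair-family averaging (the weights of a cone ∕ digital family are the
consumer's), NOT the variance letter, NOT hFlat; nothing of Bałaban's analysis; TUBE-REG∘, GAP♯∘, EXW∘, S2β, crux 20520 NOT proved; no registered stub is closed; rung R3 = SU(2) YM₃ on
T³ — NOT d = 4, NOT infinite volume, NOT a mass gap, NOT Clay; the Yang–Mills mass gap is NOT proved.  Sorry-free, axioms standard.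

References: T. Bałaban, CMP **98** (1985) 17–51 [Balaban1985Averaging] ((9) p.19, (19) p.21); CMP **99** (1985) 75–102 [Balaban1985RegularSpaces] (Lemma 1 p.79: «elementary
reasoning» = iterated lassos); CMP **95** (1984) 17–40 [Balaban1984PropagatorsI] ((1.7) p.18); CMP **96** (1984) 223–250 [Balaban1984PropagatorsII] ((1.33)).
-/

set_option autoImplicit false

noncomputable section

namespace Summit.QuantumFields.YangMills.Theorems.FluctuationComparisonRegPrIntLS2BetaKLegStaircaseStokes

open Finset
open Literature.MathematicalPhysics.QuantumFieldTheory.Balaban1983to89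
open B10Eq47AxialChi (shiftN shiftN_zero shiftN_succ rowProd rowProd_zero rowProd_succ rect rect_one_one dist1_rect_le)
open Summit.QuantumFields.YangMills.Theorems.FluctuationComparisonRegPrIntLS2BetaRowTransportVariance
  (shiftN_comm shiftN_add dist1_rect_le_unoriented dist1_rect_sq_le)

variable {G : Type*} [GaugeGroup G]

/-! ## §1 The group-level telescope: a `k`-leg comparison is a product of conjugated one-leg comparisons -/

/-- ★ **THE ROW TELESCOPE** (any gauge group): for row transporters `T₀, …, T_k` and connectors `g_i` (near), `g′_i` (far) between consecutive rows, the `k`-leg comparison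
`C_k = T₀ · (g′₀ ⋯ g′_{k−1}) · T_k⁻¹ · (g₀ ⋯ g_{k−1})⁻¹` satisfies `dist1 C_k ≤ Σ_{i<k} dist1 (T_i · g′_i · T_{i+1}⁻¹ · g_i⁻¹)`: the gluing identity
`C_{k+1} = C_k · [G_k · (T_k g′_k T_{k+1}⁻¹ g_k⁻¹) · G_k⁻¹]`, `G_k = g₀ ⋯ g_{k−1}`, with conjugation invariance and subadditivity of `dist1` (the «elementary reasoning» of the lasso
argument). [cite: Balaban1985RegularSpaces, Lemma 1 p.79; Balaban1985Averaging, (19) p.21] -/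
theorem dist1_rowTelescope_le (T g g' : ℕ → G) :
    ∀ k : ℕ, dist1 (T 0 * ((List.range k).map g').prod * (T k)⁻¹ * (((List.range k).map g).prod)⁻¹) ≤
      ∑ i ∈ range k, dist1 (T i * g' i * (T (i + 1))⁻¹ * (g i)⁻¹)
  | 0 => by simp [GaugeGroup.dist1_one]
  | k + 1 => by
    rw [List.prod_range_succ, List.prod_range_succ, Finset.sum_range_succ]
    have e : T 0 * (((List.range k).map g').prod * g' k) * (T (k + 1))⁻¹ * (((List.range k).map g).prod * g k)⁻¹ =
        (T 0 * ((List.range k).map g').prod * (T k)⁻¹ * (((List.range k).map g).prod)⁻¹) *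
          (((List.range k).map g).prod * (T k * g' k * (T (k + 1))⁻¹ * (g k)⁻¹) * (((List.range k).map g).prod)⁻¹) := by
      group
    rw [e]
    calc _ ≤ dist1 (T 0 * ((List.range k).map g').prod * (T k)⁻¹ * (((List.range k).map g).prod)⁻¹) +
          dist1 (((List.range k).map g).prod * (T k * g' k * (T (k + 1))⁻¹ * (g k)⁻¹) * (((List.range k).map g).prod)⁻¹) :=
          GaugeGroup.dist1_mul_le _ _
      _ = dist1 (T 0 * ((List.range k).map g').prod * (T k)⁻¹ * (((List.range k).map g).prod)⁻¹) +
          dist1 (T k * g' k * (T (k + 1))⁻¹ * (g k)⁻¹) := by rw [GaugeGroup.dist1_conj]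
      _ ≤ _ := add_le_add (dist1_rowTelescope_le T g g' k) le_rfl

/-- The squared edition of the row telescope (Cauchy–Schwarz over the `k` legs): `dist1 C_k² ≤ k · Σ_{i<k} dist1 (T_i g′_i T_{i+1}⁻¹ g_i⁻¹)²`.
[cite: Balaban1985RegularSpaces, Lemma 1 p.79; Balaban1985Averaging, (19) p.21] -/
theorem dist1_rowTelescope_sq_le (T g g' : ℕ → G) (k : ℕ) :
    dist1 (T 0 * ((List.range k).map g').prod * (T k)⁻¹ * (((List.range k).map g).prod)⁻¹) ^ 2 ≤
      (k : ℝ) * ∑ i ∈ range k, dist1 (T i * g' i * (T (i + 1))⁻¹ * (g i)⁻¹) ^ 2 := by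
  refine (pow_le_pow_left₀ (GaugeGroup.dist1_nonneg _) (dist1_rowTelescope_le T g g' k) 2).trans ?_
  have h := @sq_sum_le_card_mul_sum_sq ℕ ℝ _ _ _ _ (range k) (fun i => dist1 (T i * g' i * (T (i + 1))⁻¹ * (g i)⁻¹))
  rwa [Finset.card_range] at h

/-! ## §2 The one-leg terms on the lattice -/

variable {P : Params} {j : ℕ}

/-- **A FORWARD leg sweeps a rectangle on the nose**: for the leg from `b` to `b + n e_ν`, `T_b · [far connector] · T_{b + n e_ν}⁻¹ · [near connector]⁻¹ = U(∂R)` for the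
`N × n` rectangle `R` based at `b` with sides `N e_μ`, `n e_ν` (definitional: this IS lit `rect`). [cite: Balaban1985Averaging, (9) p.19] -/
theorem oneLeg_fwd_eq_rect (U : GaugeField P j G) (b : Site P j) (μ ν : Fin P.d) (N n : ℕ) :
    rowProd U b μ N * rowProd U (shiftN b μ N) ν n * (rowProd U (shiftN b ν n) μ N)⁻¹ * (rowProd U b ν n)⁻¹ = rect U b μ ν N n := rfl

/-- **A BACKWARD leg sweeps a conjugate of the inverse rectangle**: for the leg from `b + n e_ν` DOWN to `b` (near connector `(rowProd U b ν n)⁻¹`, far connector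
`(rowProd U (b + N e_μ) ν n)⁻¹`), the one-leg term is `h⁻¹ · U(∂R)⁻¹ · h`, `h` the upward near connector, so its `dist1` is `dist1 U(∂R)`, `R` the `N × n` rectangle based at
the LOWER corner `b`. [cite: Balaban1985Averaging, (9) p.19, (19) p.21] -/
theorem dist1_oneLeg_bwd_eq (U : GaugeField P j G) (b : Site P j) (μ ν : Fin P.d) (N n : ℕ) :
    dist1 (rowProd U (shiftN b ν n) μ N * (rowProd U (shiftN b μ N) ν n)⁻¹ * (rowProd U b μ N)⁻¹ * ((rowProd U b ν n)⁻¹)⁻¹) =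
      dist1 (rect U b μ ν N n) := by
  have e : rowProd U (shiftN b ν n) μ N * (rowProd U (shiftN b μ N) ν n)⁻¹ * (rowProd U b μ N)⁻¹ * ((rowProd U b ν n)⁻¹)⁻¹ =
      (rowProd U b ν n)⁻¹ * (rect U b μ ν N n)⁻¹ * ((rowProd U b ν n)⁻¹)⁻¹ := by
    unfold rect
    group
  rw [e, GaugeGroup.dist1_conj, GaugeGroup.dist1_inv]

/-! ## §3 The signed `k`-leg staircase: Stokes for the swept staircase surface -/

/-- ★★ **k-LEG TAXICAB STAIRCASE STOKES** (any gauge group, any torus).  Data: corners `z₀, z₁, …` (`z : ℕ → Site`), transverse directions `ν_i`, leg lengths `n_i`, signs `s_i`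
(`true` = forward: `z_{i+1} = z_i + n_i e_{ν_i}`; `false` = backward: `z_i = z_{i+1} + n_i e_{ν_i}`), row direction `μ`, row length `N`.  The comparison holonomy of the rows through
`z₀` and `z_k` along the `k`-leg connector — `C = T_{z₀} · Γ^{far} · T_{z_k}⁻¹ · (Γ^{near})⁻¹`, `Γ^{near} = Π_{i<k} g_i` with `g_i = rowProd U z_i ν_i n_i` (forward) ∕
`(rowProd U z_{i+1} ν_i n_i)⁻¹` (backward), `Γ^{far}` the same read from the translates `z_i + N e_μ` — satisfies `dist1 C ≤ Σ_{i<k} dist1 U(∂R_i)`, `R_i` the `N × n_i` rectangle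
in the `(μ, ν_i)`-plane based at the LOWER corner of leg `i`.  (7)'s FF ∕ FB staircases are `k = 2`. [cite: Balaban1985Averaging, (9) p.19, (19) p.21; Balaban1985RegularSpaces, Lemma 1 p.79] -/
theorem dist1_stairCompare_le_sum_rect (U : GaugeField P j G) (μ : Fin P.d) (N : ℕ) (z : ℕ → Site P j) (ν : ℕ → Fin P.d) (n : ℕ → ℕ)
    (s : ℕ → Bool) (k : ℕ)
    (hz : ∀ i, i < k → (s i = true → z (i + 1) = shiftN (z i) (ν i) (n i)) ∧ (s i = false → z i = shiftN (z (i + 1)) (ν i) (n i))) :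
    dist1 (rowProd U (z 0) μ N *
        ((List.range k).map fun i =>
          if s i then rowProd U (shiftN (z i) μ N) (ν i) (n i) else (rowProd U (shiftN (z (i + 1)) μ N) (ν i) (n i))⁻¹).prod *
        (rowProd U (z k) μ N)⁻¹ *
        (((List.range k).map fun i =>
          if s i then rowProd U (z i) (ν i) (n i) else (rowProd U (z (i + 1)) (ν i) (n i))⁻¹).prod)⁻¹) ≤
      ∑ i ∈ range k, dist1 (rect U (if s i then z i else z (i + 1)) μ (ν i) N (n i)) := by
  refine (dist1_rowTelescope_le (fun i => rowProd U (z i) μ N)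
    (fun i => if s i then rowProd U (z i) (ν i) (n i) else (rowProd U (z (i + 1)) (ν i) (n i))⁻¹)
    (fun i => if s i then rowProd U (shiftN (z i) μ N) (ν i) (n i) else (rowProd U (shiftN (z (i + 1)) μ N) (ν i) (n i))⁻¹) k).trans
    (Finset.sum_le_sum fun i hi => le_of_eq ?_)
  rw [Finset.mem_range] at hi
  obtain ⟨hf, hb⟩ := hz i hi
  cases hsi : s i
  · -- backward leg: `z i = z (i+1) + n e_ν`
    have hzi := hb hsi
    simp only [Bool.false_eq_true, ↓reduceIte]
    rw [hzi]
    exact dist1_oneLeg_bwd_eq U (z (i + 1)) μ (ν i) N (n i)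
  · -- forward leg: `z (i+1) = z i + n e_ν`
    have hzi := hf hsi
    simp only [↓reduceIte]
    rw [hzi]
    rfl

/-- ★★ **The squared edition**: `dist1 C² ≤ k · Σ_{i<k} dist1 U(∂R_i)²` (Cauchy–Schwarz over the legs). [cite: Balaban1985Averaging, (19) p.21; Balaban1985RegularSpaces, Lemma 1 p.79] -/
theorem dist1_stairCompare_sq_le (U : GaugeField P j G) (μ : Fin P.d) (N : ℕ) (z : ℕ → Site P j) (ν : ℕ → Fin P.d) (n : ℕ → ℕ)
    (s : ℕ → Bool) (k : ℕ)
    (hz : ∀ i, i < k → (s i = true → z (i + 1) = shiftN (z i) (ν i) (n i)) ∧ (s i = false → z i = shiftN (z (i + 1)) (ν i) (n i))) :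
    dist1 (rowProd U (z 0) μ N *
        ((List.range k).map fun i =>
          if s i then rowProd U (shiftN (z i) μ N) (ν i) (n i) else (rowProd U (shiftN (z (i + 1)) μ N) (ν i) (n i))⁻¹).prod *
        (rowProd U (z k) μ N)⁻¹ *
        (((List.range k).map fun i =>
          if s i then rowProd U (z i) (ν i) (n i) else (rowProd U (z (i + 1)) (ν i) (n i))⁻¹).prod)⁻¹) ^ 2 ≤
      (k : ℝ) * ∑ i ∈ range k, dist1 (rect U (if s i then z i else z (i + 1)) μ (ν i) N (n i)) ^ 2 := by
  refine (pow_le_pow_left₀ (GaugeGroup.dist1_nonneg _) (dist1_stairCompare_le_sum_rect U μ N z ν n s k hz) 2).trans ?_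
  have h := @sq_sum_le_card_mul_sum_sq ℕ ℝ _ _ _ _ (range k) (fun i => dist1 (rect U (if s i then z i else z (i + 1)) μ (ν i) N (n i)))
  rwa [Finset.card_range] at h

/-- The linear bound in PLAQUETTE form (`μ ≠ ν_i` for every leg): `dist1 C ≤ Σ_{i<k} Σ_{t<n_i} Σ_{s<N} dist1 U(∂p_{i;s,t})`, `p_{i;s,t}` the plaquette of `R_i` at
`b_i + s e_μ + t e_{ν_i}` (written as the `1 × 1` rectangle holonomy, orientation-free), `b_i` the lower corner of leg `i`. [cite: Balaban1985Averaging, (19) p.21] -/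
theorem dist1_stairCompare_le_plaq (U : GaugeField P j G) (μ : Fin P.d) (N : ℕ) (z : ℕ → Site P j) (ν : ℕ → Fin P.d) (n : ℕ → ℕ)
    (s : ℕ → Bool) (k : ℕ) (hμν : ∀ i, i < k → μ ≠ ν i)
    (hz : ∀ i, i < k → (s i = true → z (i + 1) = shiftN (z i) (ν i) (n i)) ∧ (s i = false → z i = shiftN (z (i + 1)) (ν i) (n i))) :
    dist1 (rowProd U (z 0) μ N *
        ((List.range k).map fun i =>
          if s i then rowProd U (shiftN (z i) μ N) (ν i) (n i) else (rowProd U (shiftN (z (i + 1)) μ N) (ν i) (n i))⁻¹).prod *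
        (rowProd U (z k) μ N)⁻¹ *
        (((List.range k).map fun i =>
          if s i then rowProd U (z i) (ν i) (n i) else (rowProd U (z (i + 1)) (ν i) (n i))⁻¹).prod)⁻¹) ≤
      ∑ i ∈ range k, ∑ t ∈ range (n i), ∑ r ∈ range N,
        dist1 (rect U (shiftN (shiftN (if s i then z i else z (i + 1)) (ν i) t) μ r) μ (ν i) 1 1) :=
  (dist1_stairCompare_le_sum_rect U μ N z ν n s k hz).trans
    (Finset.sum_le_sum fun i hi => dist1_rect_le_unoriented U _ (hμν i (Finset.mem_range.1 hi)) N (n i))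

/-- ★★ **The squared edition in PLAQUETTE form** (`μ ≠ ν_i`): `dist1 C² ≤ k · Σ_{i<k} (N·n_i) · Σ_{t<n_i} Σ_{s<N} dist1 U(∂p_{i;s,t})²` — Cauchy–Schwarz over the legs, then (7)'s
Stokes in squares on each swept rectangle; this is the form a diffuse pair family averages (the weight of a plaquette = how often the family's rectangles cover it).
[cite: Balaban1985Averaging, (19) p.21; Balaban1985RegularSpaces, Lemma 1 p.79] -/
theorem dist1_stairCompare_sq_le_plaq (U : GaugeField P j G) (μ : Fin P.d) (N : ℕ) (z : ℕ → Site P j) (ν : ℕ → Fin P.d) (n : ℕ → ℕ)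
    (s : ℕ → Bool) (k : ℕ) (hμν : ∀ i, i < k → μ ≠ ν i)
    (hz : ∀ i, i < k → (s i = true → z (i + 1) = shiftN (z i) (ν i) (n i)) ∧ (s i = false → z i = shiftN (z (i + 1)) (ν i) (n i))) :
    dist1 (rowProd U (z 0) μ N *
        ((List.range k).map fun i =>
          if s i then rowProd U (shiftN (z i) μ N) (ν i) (n i) else (rowProd U (shiftN (z (i + 1)) μ N) (ν i) (n i))⁻¹).prod *
        (rowProd U (z k) μ N)⁻¹ *
        (((List.range k).map fun i =>
          if s i then rowProd U (z i) (ν i) (n i) else (rowProd U (z (i + 1)) (ν i) (n i))⁻¹).prod)⁻¹) ^ 2 ≤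
      (k : ℝ) * ∑ i ∈ range k, ((N * n i : ℕ) : ℝ) * ∑ t ∈ range (n i), ∑ r ∈ range N,
        dist1 (rect U (shiftN (shiftN (if s i then z i else z (i + 1)) (ν i) t) μ r) μ (ν i) 1 1) ^ 2 :=
  (dist1_stairCompare_sq_le U μ N z ν n s k hz).trans
    (mul_le_mul_of_nonneg_left
      (Finset.sum_le_sum fun i hi => dist1_rect_sq_le U _ (hμν i (Finset.mem_range.1 hi)) N (n i)) (Nat.cast_nonneg k))

/-! ## §4 The monotone staircase (all legs forward): no signs -/

/-- **The all-forward staircase**: corners `z_{i+1} = z_i + n_i e_{ν_i}`, connectors `Γ = Π_{i<k} rowProd U z_i ν_i n_i`; `dist1 C ≤ Σ_{i<k} dist1 U(∂R_i)`, `R_i` based at `z_i`.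
[cite: Balaban1985Averaging, (9) p.19, (19) p.21; Balaban1985RegularSpaces, Lemma 1 p.79] -/
theorem dist1_stairCompareFwd_le_sum_rect (U : GaugeField P j G) (μ : Fin P.d) (N : ℕ) (z : ℕ → Site P j) (ν : ℕ → Fin P.d) (n : ℕ → ℕ) (k : ℕ)
    (hz : ∀ i, i < k → z (i + 1) = shiftN (z i) (ν i) (n i)) :
    dist1 (rowProd U (z 0) μ N * ((List.range k).map fun i => rowProd U (shiftN (z i) μ N) (ν i) (n i)).prod * (rowProd U (z k) μ N)⁻¹ *
        (((List.range k).map fun i => rowProd U (z i) (ν i) (n i)).prod)⁻¹) ≤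
      ∑ i ∈ range k, dist1 (rect U (z i) μ (ν i) N (n i)) := by
  refine (dist1_rowTelescope_le (fun i => rowProd U (z i) μ N) (fun i => rowProd U (z i) (ν i) (n i))
    (fun i => rowProd U (shiftN (z i) μ N) (ν i) (n i)) k).trans (Finset.sum_le_sum fun i hi => le_of_eq ?_)
  rw [Finset.mem_range] at hi
  show dist1 (rowProd U (z i) μ N * rowProd U (shiftN (z i) μ N) (ν i) (n i) * (rowProd U (z (i + 1)) μ N)⁻¹ * (rowProd U (z i) (ν i) (n i))⁻¹) = _
  rw [hz i hi]
  rfl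

/-- **The all-forward staircase, squared, in plaquette form** (`μ ≠ ν_i`): `dist1 C² ≤ k · Σ_{i<k} (N·n_i) · Σ_{t<n_i} Σ_{s<N} dist1 U(∂p_{i;s,t})²`.
[cite: Balaban1985Averaging, (19) p.21; Balaban1985RegularSpaces, Lemma 1 p.79] -/
theorem dist1_stairCompareFwd_sq_le_plaq (U : GaugeField P j G) (μ : Fin P.d) (N : ℕ) (z : ℕ → Site P j) (ν : ℕ → Fin P.d) (n : ℕ → ℕ) (k : ℕ)
    (hμν : ∀ i, i < k → μ ≠ ν i) (hz : ∀ i, i < k → z (i + 1) = shiftN (z i) (ν i) (n i)) :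
    dist1 (rowProd U (z 0) μ N * ((List.range k).map fun i => rowProd U (shiftN (z i) μ N) (ν i) (n i)).prod * (rowProd U (z k) μ N)⁻¹ *
        (((List.range k).map fun i => rowProd U (z i) (ν i) (n i)).prod)⁻¹) ^ 2 ≤
      (k : ℝ) * ∑ i ∈ range k, ((N * n i : ℕ) : ℝ) * ∑ t ∈ range (n i), ∑ r ∈ range N,
        dist1 (rect U (shiftN (shiftN (z i) (ν i) t) μ r) μ (ν i) 1 1) ^ 2 := by
  refine (pow_le_pow_left₀ (GaugeGroup.dist1_nonneg _) (dist1_stairCompareFwd_le_sum_rect U μ N z ν n k hz) 2).trans ?_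
  have h := @sq_sum_le_card_mul_sum_sq ℕ ℝ _ _ _ _ (range k) (fun i => dist1 (rect U (z i) μ (ν i) N (n i)))
  rw [Finset.card_range] at h
  exact h.trans (mul_le_mul_of_nonneg_left
    (Finset.sum_le_sum fun i hi => dist1_rect_sq_le U _ (hμν i (Finset.mem_range.1 hi)) N (n i)) (Nat.cast_nonneg k))

end Summit.QuantumFields.YangMills.Theorems.FluctuationComparisonRegPrIntLS2BetaKLegStaircaseStokes

end
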